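import Mathlib
import Summits.Ventures.HodgeRepro.Tier4.Common.RowPlane
import Summits.Ventures.HodgeRepro.Tier4.Common.RowWeights
import Summits.Ventures.HodgeRepro.Tier4.Line1.TotallyDefiniteCompact
import Summits.Ventures.HodgeRepro.Tier4.Line4.DefiniteCompact

/-!
# Tier4/Line4/DefiniteCompactRow — C-L4-DEF-COMPACT (B): the row plane `⟨a⟩ ⊕ ⟨ε b⟩` is definite at a real place where
the lines have the sign pattern of the CM datum, hence its slice `U(W)(k_w)` is compact; `hcpt` of `archBallGrowth_of_slice`
for the mixed row plane (with a transported torus) from L1-p5's displayed `hdef` clause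

Blind re-derivation cell `pub-hodge-repro`, Tier 4 «prove the step» (README §9–§10), seat t4-L1-p2 (prover, LINE L1, gen 5;
L4 service cut C-L4-DEF-COMPACT (B), plan-4 g6 S15640; statements = t4-L1-p1 g4's S15619 (B) verbatim, read at statement
S15621 / S15625; recipe S15628 (2)).  Tree path `lean/Summits/Ventures/HodgeRepro/Tier4/Line4/DefiniteCompactRow.lean`.
Mathlib-level; no literature.

THE STATEMENTS (every declaration sorry-free, axioms `[propext, Classical.choice, Quot.sound]`).
* `posDef_lineGramRowR (hcm : t² < 4 n) (ha : 0 < a) : (lineGramRowR t n a).PosDef` — the `2 × 2` row Gram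
  `a • !![2n, −t; −t, 2]` is positive definite when the quadratic `X² − t X + n` has no real root and `a > 0`
  (`x G xᵀ = (a/2) [(2 x₁ − t x₀)² + (4n − t²) x₀²]`); `neg_lineGramRowR` gives the negative case.
* `posDef_fromBlocks_zero (hA : A.PosDef) (hD : D.PosDef) : (fromBlocks A 0 0 D).PosDef` — a block-diagonal matrix of positive
  definite blocks is positive definite (`fromBlocks_mulVec`, `sumElim_dotProduct_sumElim`).
* `ofLinesRow_B_map` — the real Gram matrix `B.map σ` of `PlaneData.ofLinesRow q a b ε` as a reindexed block matrix of
  `lineGramRowR (σ t) (σ n) (σ a)` and `lineGramRowR (σ t) (σ n) (σ (ε b))` (`lineGramRow_map`, `fromBlocks_map`).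
* **`posDef_or_negDef_ofLinesRow_of_isCMAt`** — `B.map σ` is positive or negative definite when `(σ t)² < 4 σ n` and `σ a`,
  `σ (ε b)` have the same sign (general trace `t`; L1-p2 g4's `posDef_or_negDef_ofLinesRow` is the `t = 0` case).
* `adToC_re_algebraMap (hw : w.IsReal) (x : k) : (adToC w (algebraMap k (Ad k) x)).re = embedding_of_isReal hw x` — the
  dictionary between the line's sign clause (written with `adToC`) and the definiteness binder of `isCompact_atPlace_of_definite`.
* **`isCompact_atPlace_ofLinesRow_of_signs (q) (a b ε) (hw : w.IsReal) (hcm : IsCMAt q w) (hab : 0 < (adToC w a).re ·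
  (adToC w (ε b)).re) : IsCompact (atPlace (ofLinesRow q a b ε) w)`** — S15619 (B), first statement: definiteness at `w`
  from `IsCMAt` (`t_w² < 4 n_w`) and the sign clause, then L1-p1's bridge `isCompact_atPlace_of_definite` (p710009).
* **`hcpt_mixedRow_of_hdef (q) (a b) (g g' hgg' hg'g hgΩ) (w₀) (hdef : ∀ w′ ≠ w₀, w′.IsReal ∧ IsCMAt q w′ ∧ 0 < (adToC w′ a).re ·
  (adToC w′ (−1 · b)).re) : ∀ w ≠ w₀, IsCompact (atPlace ((mixedRow q a b).withTransportedTorus g g' hgg' hg'g hgΩ) w)`** —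
  S15619 (B), second statement = the `hcpt` binder of `archBallGrowth_of_slice` (ArchBallProduct p709699) for the line's plane
  from L1-p5's `hdef` clause (ArchIntegrableOfGrowth's shape); `withTransportedTorus` keeps `B` and `Ω`, so the group, the
  slice and the compactness are those of `mixedRow q a b` by `rfl`.
* `posDef_or_negDef_of_congr_smul` and **`hcpt_withTransportedTorus_of_iso`** — the SAME `hcpt` from the OTHER row plane's
  sign clause through the seesaw isometry `g · B(a₁, a₃) · gᵀ = λ · B(a₀, a₂)` (`λ ≠ 0`): definiteness is transported along a
  congruence by an invertible matrix and a non-zero scalar (`PosDef.conjTranspose_mul_mul_same`, `PosDef.smul`) — so (7a)'s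
  displayed `hdef` on `(a 1, a 3)` (ArchMatchingSeesaw p709235, binder `_hiso`) already yields the slice compactness of the seesaw
  plane `(mixedRow q (a 0) (a 2)).withTransportedTorus …`, without a second sign clause on `(a 0, a 2)` (crit-2 S15621 record (ii)).

Nothing here says anything about the status of the Hodge conjecture for CM abelian varieties, which is NOT proved
(HC_CM is NOT proved by anyone in this repository).
-/

set_option autoImplicit false

noncomputable section

namespace Summit.Ventures.HodgeRepro.Tier4.Line4

open Summit.Ventures.HodgeRepro.Tier4 Summit.Ventures.HodgeRepro.Tier4.Common Summit.Ventures.HodgeRepro.Tier4.Line1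
  NumberField Matrix

/-! ## Part A — real `2 × 2` and block-diagonal `4 × 4` positivity -/

section RealBlocks

/-- The real row Gram `lineGramRowR t n a` is symmetric (Hermitian over `ℝ`). -/
theorem isHermitian_lineGramRowR (t n a : ℝ) : (lineGramRowR t n a).IsHermitian := by
  ext i j
  fin_cases i <;> fin_cases j <;> simp [lineGramRowR, Matrix.conjTranspose_apply]

/-- `-(lineGramRowR t n a) = lineGramRowR t n (-a)`. -/
theorem neg_lineGramRowR (t n a : ℝ) : -(lineGramRowR t n a) = lineGramRowR t n (-a) := by
  simp only [lineGramRowR, neg_smul]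

/-- **The row Gram `a • !![2n, −t; −t, 2]` is positive definite** for `t² < 4 n` and `a > 0`:
`x G xᵀ = (a / 2) · ((2 x₁ − t x₀)² + (4 n − t²) x₀²)`. -/
theorem posDef_lineGramRowR {t n a : ℝ} (hcm : t ^ 2 < 4 * n) (ha : 0 < a) : (lineGramRowR t n a).PosDef := by
  refine Matrix.PosDef.of_dotProduct_mulVec_pos (isHermitian_lineGramRowR t n a) fun x hx => ?_
  have hx' : x 0 ≠ 0 ∨ x 1 ≠ 0 := by
    by_contra h
    rw [not_or, not_not, not_not] at h
    exact hx (funext fun i => by fin_cases i <;> simp [h.1, h.2])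
  have hform : star x ⬝ᵥ (lineGramRowR t n a *ᵥ x) =
      a * ((2 * x 1 - t * x 0) ^ 2 + (4 * n - t ^ 2) * x 0 ^ 2) / 2 := by
    simp only [lineGramRowR, star_trivial, Matrix.mulVec, dotProduct, Fin.sum_univ_two, Matrix.smul_apply,
      Matrix.of_apply, Matrix.cons_val', Matrix.cons_val_zero, Matrix.cons_val_one,
      Matrix.empty_val', Matrix.cons_val_fin_one, smul_eq_mul]
    ring
  rw [hform]
  have h4 : 0 < 4 * n - t ^ 2 := by linarith
  rcases hx' with h0 | h1
  · have hsq : 0 < x 0 ^ 2 := by positivity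
    have : 0 < (4 * n - t ^ 2) * x 0 ^ 2 := mul_pos h4 hsq
    have : 0 ≤ (2 * x 1 - t * x 0) ^ 2 := sq_nonneg _
    have : 0 < a * ((2 * x 1 - t * x 0) ^ 2 + (4 * n - t ^ 2) * x 0 ^ 2) := mul_pos ha (by linarith)
    linarith
  · rcases eq_or_ne (x 0) 0 with h0 | h0
    · have hsq : 0 < x 1 ^ 2 := by positivity
      have : 0 < a * ((2 * x 1 - t * x 0) ^ 2 + (4 * n - t ^ 2) * x 0 ^ 2) := by
        rw [h0]
        have : 0 < (2 * x 1 - t * 0) ^ 2 := by nlinarith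
        nlinarith
      linarith
    · have hsq : 0 < x 0 ^ 2 := by positivity
      have : 0 < (4 * n - t ^ 2) * x 0 ^ 2 := mul_pos h4 hsq
      have : 0 ≤ (2 * x 1 - t * x 0) ^ 2 := sq_nonneg _
      have : 0 < a * ((2 * x 1 - t * x 0) ^ 2 + (4 * n - t ^ 2) * x 0 ^ 2) := mul_pos ha (by linarith)
      linarith

/-- The quadratic form of a block-diagonal matrix on a `Sum.elim` vector splits. -/
theorem sumElim_dotProduct_fromBlocks_zero_mulVec {m l : Type} [Fintype m] [Fintype l]
    (A : Matrix m m ℝ) (D : Matrix l l ℝ) (u : m → ℝ) (v : l → ℝ) :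
    Sum.elim u v ⬝ᵥ (Matrix.fromBlocks A 0 0 D *ᵥ Sum.elim u v) = u ⬝ᵥ (A *ᵥ u) + v ⬝ᵥ (D *ᵥ v) := by
  rw [Matrix.fromBlocks_mulVec, Matrix.zero_mulVec, Matrix.zero_mulVec, add_zero, zero_add, Sum.elim_comp_inl,
    Sum.elim_comp_inr, sumElim_dotProduct_sumElim]

/-- **A block-diagonal matrix of positive definite blocks is positive definite.** -/
theorem posDef_fromBlocks_zero {m l : Type} [Fintype m] [Fintype l] [DecidableEq m] [DecidableEq l]
    {A : Matrix m m ℝ} {D : Matrix l l ℝ} (hA : A.PosDef) (hD : D.PosDef) :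
    (Matrix.fromBlocks A 0 0 D).PosDef := by
  refine Matrix.PosDef.of_dotProduct_mulVec_pos ?_ fun x hx => ?_
  · rw [Matrix.IsHermitian, Matrix.fromBlocks_conjTranspose, hA.1.eq, hD.1.eq]
    simp only [Matrix.conjTranspose_zero]
  · obtain ⟨u, v, rfl⟩ : ∃ u v, x = Sum.elim u v := ⟨x ∘ Sum.inl, x ∘ Sum.inr, (Sum.elim_comp_inl_inr x).symm⟩
    rw [star_trivial, sumElim_dotProduct_fromBlocks_zero_mulVec]
    have huv : u ≠ 0 ∨ v ≠ 0 := by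
      by_contra h
      rw [not_or, not_not, not_not] at h
      exact hx (by rw [h.1, h.2]; funext i; rcases i with i | i <;> rfl)
    have hu0 : 0 ≤ u ⬝ᵥ (A *ᵥ u) := by
      have := (Matrix.posSemidef_iff_dotProduct_mulVec.1 hA.posSemidef).2 u
      rwa [star_trivial] at this
    have hv0 : 0 ≤ v ⬝ᵥ (D *ᵥ v) := by
      have := (Matrix.posSemidef_iff_dotProduct_mulVec.1 hD.posSemidef).2 v
      rwa [star_trivial] at this
    rcases huv with hu | hv
    · have := hA.dotProduct_mulVec_pos hu
      rw [star_trivial] at this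
      linarith
    · have := hD.dotProduct_mulVec_pos hv
      rw [star_trivial] at this
      linarith

end RealBlocks

/-! ## Part B — the row plane is definite at a real place with the CM sign pattern -/

section RowPlaneDefinite

variable {k : Type} [Field k]

/-- `ε • lineGramRow q b = lineGramRow q (ε * b)`. -/
theorem smul_lineGramRow (q : QuadData k) (ε b : k) : ε • lineGramRow q b = lineGramRow q (ε * b) := by
  simp only [lineGramRow, smul_smul]

/-- **The real Gram matrix of the row plane** `⟨a⟩ ⊕ ⟨ε b⟩` at `σ`: the reindexed block matrix of the two real row Grams. -/
theorem ofLinesRow_B_map (q : QuadData k) (a b ε : k) (σ : k →+* ℝ) :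
    ((PlaneData.ofLinesRow q a b ε).B).map σ =
      (Matrix.fromBlocks (lineGramRowR (σ q.t) (σ q.n) (σ a)) 0 0
        (lineGramRowR (σ q.t) (σ q.n) (σ (ε * b)))).submatrix finSumFinEquiv.symm finSumFinEquiv.symm := by
  rw [ofLinesRow_B, smul_lineGramRow]
  simp only [blockDiag4, re4, Matrix.coe_reindexAlgEquiv, Matrix.reindex_apply, ← Matrix.submatrix_map,
    Matrix.fromBlocks_map, Matrix.map_zero σ (map_zero σ), lineGramRow_map]

/-- **Definiteness of the row plane at a real embedding `σ`, general trace**: for `(σ t)² < 4 σ n` and `σ a`, `σ (ε b)` of the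
same sign, `B.map σ` is positive or negative definite. -/
theorem posDef_or_negDef_ofLinesRow_of_isCMAt (q : QuadData k) (a b ε : k) (σ : k →+* ℝ)
    (hcm : (σ q.t) ^ 2 < 4 * σ q.n) (hpos : (0 < σ a ∧ 0 < σ (ε * b)) ∨ (σ a < 0 ∧ σ (ε * b) < 0)) :
    ((PlaneData.ofLinesRow q a b ε).B.map σ).PosDef ∨ (-((PlaneData.ofLinesRow q a b ε).B.map σ)).PosDef := by
  rw [ofLinesRow_B_map]
  rcases hpos with ⟨ha, hb⟩ | ⟨ha, hb⟩
  · left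
    exact Matrix.PosDef.submatrix (posDef_fromBlocks_zero (posDef_lineGramRowR hcm ha) (posDef_lineGramRowR hcm hb))
      finSumFinEquiv.symm.injective
  · right
    show ((-(Matrix.fromBlocks (lineGramRowR (σ q.t) (σ q.n) (σ a)) 0 0
      (lineGramRowR (σ q.t) (σ q.n) (σ (ε * b))))).submatrix finSumFinEquiv.symm finSumFinEquiv.symm).PosDef
    rw [Matrix.fromBlocks_neg, neg_zero, neg_lineGramRowR, neg_lineGramRowR]
    exact Matrix.PosDef.submatrix
      (posDef_fromBlocks_zero (posDef_lineGramRowR hcm (neg_pos.2 ha)) (posDef_lineGramRowR hcm (neg_pos.2 hb)))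
      finSumFinEquiv.symm.injective

end RowPlaneDefinite

/-! ## Part C — the dictionary `adToC ↔ embedding_of_isReal` at a real place, and the compact slice -/

section Slice

variable {k : Type} [Field k] [NumberField k]

/-- At a real place the real part of `adToC w x` is L1-p2 g4's `realEntry hw x`. -/
theorem adToC_re_eq_realEntry {w : InfinitePlace k} (hw : w.IsReal) (x : Ad k) :
    (adToC w x).re = realEntry hw x := by
  show (InfinitePlace.Completion.extensionEmbedding w (adComponentInf k w x)).re =
    InfinitePlace.Completion.extensionEmbeddingOfIsReal hw (adComponentInf k w x)
  rw [← InfinitePlace.Completion.extensionEmbeddingOfIsReal_apply hw, Complex.ofReal_re]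

/-- **The dictionary**: the real part of `adToC w` of a principal adele is the real embedding attached to the place. -/
theorem adToC_re_algebraMap {w : InfinitePlace k} (hw : w.IsReal) (x : k) :
    (adToC w (algebraMap k (Ad k) x)).re = InfinitePlace.embedding_of_isReal hw x := by
  rw [adToC_re_eq_realEntry hw, realEntry_algebraMap hw]

/-- `IsCMAt q w` at a real place, read through the real embedding. -/
theorem isCMAt_iff_embedding {q : QuadData k} {w : InfinitePlace k} (hw : w.IsReal) :
    IsCMAt q w ↔ (InfinitePlace.embedding_of_isReal hw q.t) ^ 2 < 4 * InfinitePlace.embedding_of_isReal hw q.n := by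
  rw [IsCMAt, ← adToC_t, ← adToC_n, adToC_re_algebraMap hw, adToC_re_algebraMap hw]

/-- **C-L4-DEF-COMPACT (B), first statement: the slice of the row plane at a real place with the CM sign pattern is compact.**
`IsCMAt q w` (`t_w² < 4 n_w`) and the sign clause `0 < a_w · (ε b)_w` make `B.map σ_w` definite; L1-p1's bridge
`isCompact_atPlace_of_definite` (p710009) does the rest. -/
theorem isCompact_atPlace_ofLinesRow_of_signs (q : QuadData k) (a b ε : k) {w : InfinitePlace k} (hw : w.IsReal)
    (hcm : IsCMAt q w)
    (hab : 0 < (adToC w (algebraMap k (Ad k) a)).re * (adToC w (algebraMap k (Ad k) (ε * b))).re) :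
    IsCompact (atPlace (PlaneData.ofLinesRow q a b ε) w : Set (GA (PlaneData.ofLinesRow q a b ε))) := by
  apply isCompact_atPlace_of_definite _ hw
  have hcm' := (isCMAt_iff_embedding hw).1 hcm
  rw [adToC_re_algebraMap hw, adToC_re_algebraMap hw] at hab
  exact posDef_or_negDef_ofLinesRow_of_isCMAt q a b ε (InfinitePlace.embedding_of_isReal hw) hcm' (mul_pos_iff.1 hab)

/-- **C-L4-DEF-COMPACT (B), second statement = the `hcpt` binder of `archBallGrowth_of_slice` for the line's plane**: from
L1-p5's displayed `hdef` clause (reality, `IsCMAt`, and the sign clause `0 < a_{w′} · (−b)_{w′}` at every `w′ ≠ w₀`), every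
slice of `(mixedRow q a b).withTransportedTorus g g' hgg' hg'g hgΩ` off `w₀` is compact (`withTransportedTorus` keeps `B`
and `Ω`: the group and its slices are those of `mixedRow q a b = ofLinesRow q a b (−1)`). -/
theorem hcpt_mixedRow_of_hdef (q : QuadData k) (a b : k) (g g' : Matrix (Fin 4) (Fin 4) k) (hgg' : g * g' = 1)
    (hg'g : g' * g = 1) (hgΩ : g * (PlaneData.mixedRow q a b).Ω = (PlaneData.mixedRow q a b).Ω * g)
    (w₀ : InfinitePlace k)
    (hdef : ∀ w' : InfinitePlace k, w' ≠ w₀ → w'.IsReal ∧ IsCMAt q w' ∧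
      0 < (adToC w' (algebraMap k (Ad k) a)).re * (adToC w' (algebraMap k (Ad k) (-1 * b))).re) :
    ∀ w : InfinitePlace k, w ≠ w₀ →
      IsCompact (atPlace ((PlaneData.mixedRow q a b).withTransportedTorus g g' hgg' hg'g hgΩ) w :
        Set (GA ((PlaneData.mixedRow q a b).withTransportedTorus g g' hgg' hg'g hgΩ))) := by
  intro w hw
  obtain ⟨hreal, hcm, hab⟩ := hdef w hw
  exact isCompact_atPlace_ofLinesRow_of_signs q a b (-1) hreal hcm hab

end Slice

/-! ## Part D — definiteness through the seesaw isometry: `hcpt` of the seesaw plane from (7a)'s `hdef` on the OTHER row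
plane -/

section Iso

/-- **Definiteness is transported along a congruence by an invertible real matrix and a non-zero scalar**: from
`G N Gᵀ = l • M` with `N` positive definite and `G` invertible, `M` is positive definite for `l > 0` and negative definite
for `l < 0`. -/
theorem posDef_or_negDef_of_congr_smul {m : Type} [Fintype m] [DecidableEq m] {M N G : Matrix m m ℝ} {l : ℝ}
    (hN : N.PosDef) (hG : IsUnit G) (h : G * N * Gᵀ = l • M) :
    (0 < l → M.PosDef) ∧ (l < 0 → (-M).PosDef) := by
  have hGt : Function.Injective (Gᵀ).mulVec := Matrix.mulVec_injective_iff_isUnit.2 ((Matrix.isUnit_transpose G).2 hG)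
  have hcongr : (l • M).PosDef := by
    rw [← h]
    have := Matrix.PosDef.conjTranspose_mul_mul_same hN hGt
    rwa [Matrix.conjTranspose_eq_transpose_of_trivial, Matrix.transpose_transpose] at this
  constructor
  · intro hl
    have := Matrix.PosDef.smul hcongr (inv_pos.2 hl)
    rwa [smul_smul, inv_mul_cancel₀ hl.ne', one_smul] at this
  · intro hl
    have hl' : 0 < (-l)⁻¹ := inv_pos.2 (neg_pos.2 hl)
    have := Matrix.PosDef.smul hcongr hl'
    rwa [smul_smul, show (-l)⁻¹ * l = -1 by rw [inv_neg, neg_mul, inv_mul_cancel₀ hl.ne], neg_one_smul] at this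

/-- The `σ`-image of the seesaw isometry `g B₁ gᵀ = λ B₀`. -/
theorem map_iso {k : Type} [Field k] (σ : k →+* ℝ) {g B₁ B₀ : Matrix (Fin 4) (Fin 4) k} {lam : k}
    (hiso : g * B₁ * gᵀ = lam • B₀) :
    g.map σ * B₁.map σ * (g.map σ)ᵀ = σ lam • B₀.map σ := by
  have h := congrArg (fun A : Matrix (Fin 4) (Fin 4) k => A.map σ) hiso
  simp only [Matrix.map_mul, Matrix.transpose_map] at h
  rw [h]
  ext i j
  simp [Matrix.map_apply, Matrix.smul_apply]

/-- An invertible `k`-matrix has an invertible `σ`-image. -/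
theorem isUnit_map_of_mul_eq_one {k : Type} [Field k] (σ : k →+* ℝ) {g g' : Matrix (Fin 4) (Fin 4) k}
    (hgg' : g * g' = 1) : IsUnit (g.map σ) := by
  rw [Matrix.isUnit_iff_isUnit_det]
  have h : (g.map σ).det * (g'.map σ).det = 1 := by
    rw [← Matrix.det_mul, ← Matrix.map_mul, hgg', Matrix.map_one σ (map_zero σ) (map_one σ), Matrix.det_one]
  exact IsUnit.of_mul_eq_one _ h

/-- **Definiteness of the seesaw plane `mixedRow q (a 0) (a 2)` at `σ` from the OTHER row plane's sign pattern through the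
isometry** `g B(a 1, a 3) gᵀ = λ B(a 0, a 2)`, `λ ≠ 0`. -/
theorem posDef_or_negDef_mixedRow_of_iso {k : Type} [Field k] (q : QuadData k) (a : Fin 4 → k)
    (g g' : Matrix (Fin 4) (Fin 4) k) (hgg' : g * g' = 1) (lam : k) (hlam : lam ≠ 0)
    (hiso : g * (PlaneData.mixedRow q (a 1) (a 3)).B * gᵀ = lam • (PlaneData.mixedRow q (a 0) (a 2)).B)
    (σ : k →+* ℝ) (hcm : (σ q.t) ^ 2 < 4 * σ q.n)
    (hpos : (0 < σ (a 1) ∧ 0 < σ (-1 * a 3)) ∨ (σ (a 1) < 0 ∧ σ (-1 * a 3) < 0)) :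
    ((PlaneData.mixedRow q (a 0) (a 2)).B.map σ).PosDef ∨ (-((PlaneData.mixedRow q (a 0) (a 2)).B.map σ)).PosDef := by
  have hG := isUnit_map_of_mul_eq_one σ hgg'
  have hl : σ lam ≠ 0 := (map_ne_zero σ).2 hlam
  have h13 := posDef_or_negDef_ofLinesRow_of_isCMAt q (a 1) (a 3) (-1) σ hcm hpos
  have hmap := map_iso σ hiso
  rcases h13 with hN | hN
  · have key := posDef_or_negDef_of_congr_smul hN hG hmap
    rcases lt_or_gt_of_ne hl with hneg | hposl
    · exact Or.inr (key.2 hneg)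
    · exact Or.inl (key.1 hposl)
  · have hmap' : g.map σ * (-((PlaneData.mixedRow q (a 1) (a 3)).B.map σ)) * (g.map σ)ᵀ =
        (-(σ lam)) • (PlaneData.mixedRow q (a 0) (a 2)).B.map σ := by
      rw [Matrix.mul_neg, Matrix.neg_mul, hmap, neg_smul]
    have key := posDef_or_negDef_of_congr_smul hN hG hmap'
    rcases lt_or_gt_of_ne hl with hneg | hposl
    · exact Or.inl (key.1 (neg_pos.2 hneg))
    · exact Or.inr (key.2 (neg_neg_iff_pos.2 hposl))

/-- **`hcpt` of the seesaw plane from (7a)'s displayed `hdef` on `(a 1, a 3)`** (ArchMatchingSeesaw's binders `lam`, `_hlam`,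
`_hiso`, `hcm`, `hdef` verbatim, over a field whose places off `w₀` are real): every slice of
`(mixedRow q (a 0) (a 2)).withTransportedTorus g g' hgg' hg'g hgΩ` off `w₀` is compact. -/
theorem hcpt_withTransportedTorus_of_iso {k : Type} [Field k] [NumberField k] (q : QuadData k) (a : Fin 4 → k)
    (g g' : Matrix (Fin 4) (Fin 4) k) (hgg' : g * g' = 1) (hg'g : g' * g = 1)
    (hgΩ : g * (PlaneData.mixedRow q (a 0) (a 2)).Ω = (PlaneData.mixedRow q (a 0) (a 2)).Ω * g)
    (lam : k) (hlam : lam ≠ 0)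
    (hiso : g * (PlaneData.mixedRow q (a 1) (a 3)).B * gᵀ = lam • (PlaneData.mixedRow q (a 0) (a 2)).B)
    (w₀ : InfinitePlace k) (hreal : ∀ w : InfinitePlace k, w ≠ w₀ → w.IsReal) (hcm : ∀ w : InfinitePlace k, IsCMAt q w)
    (hdef : ∀ w' : InfinitePlace k, w' ≠ w₀ →
      0 < (adToC w' (algebraMap k (Ad k) (a 1))).re * (adToC w' (algebraMap k (Ad k) (-1 * a 3))).re) :
    ∀ w : InfinitePlace k, w ≠ w₀ →
      IsCompact (atPlace ((PlaneData.mixedRow q (a 0) (a 2)).withTransportedTorus g g' hgg' hg'g hgΩ) w :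
        Set (GA ((PlaneData.mixedRow q (a 0) (a 2)).withTransportedTorus g g' hgg' hg'g hgΩ))) := by
  intro w hw
  have hwr := hreal w hw
  have hcm' := (isCMAt_iff_embedding hwr).1 (hcm w)
  have hab := hdef w hw
  rw [adToC_re_algebraMap hwr, adToC_re_algebraMap hwr] at hab
  have hdef' := posDef_or_negDef_mixedRow_of_iso q a g g' hgg' lam hlam hiso (InfinitePlace.embedding_of_isReal hwr) hcm'
    (mul_pos_iff.1 hab)
  exact isCompact_atPlace_of_definite (PlaneData.mixedRow q (a 0) (a 2)) hwr hdef'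

end Iso

end Summit.Ventures.HodgeRepro.Tier4.Line4

end
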